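import Mathlib
import Summits.Ventures.FusionMHD.Models.CerfonFreidbergIterLikeQHalfLink
import Summits.Ventures.FusionMHD.Models.CerfonFreidbergIterLikeQ90Boxes
import Summits.Ventures.FusionMHD.Models.CerfonFreidbergIterLikeQHalfRay
import Summits.Ventures.FusionMHD.Models.CerfonFreidbergIterLikeQ90Sound
import Summits.Ventures.FusionMHD.Models.FluxSurfacePolarRayTube
import HarnessLib

/-!
# Ventures/FusionMHD — Models/CerfonFreidbergIterLikeQ90Link.lean: the PER-PANEL LINK DATA from the kernel certificates to the TRUE
# flux surface `ψ_N = 9/10` of THE Cerfon–Freidberg ITER-like instance — objects and the decidable rational side conditions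
# (`ψ_N = 9/10` SIBLING of `Models/CerfonFreidbergIterLikeQHalfLink.lean`, ★ #117)

HONEST FRAMING (LADDER-GRIDFUSION three columns; CF rung, F2 item R2).  Inputs (all in the tree): per panel `j` the Taylor-model facts of
`Models/CerfonFreidbergIterLikeQ90Sound.lean` (`sound_of_ok`), the box facts of `Models/CerfonFreidbergIterLikeQ90Boxes.lean`
(`BoxData.sound`), the calculus of `Models/CerfonFreidbergIterLikeQHalfRay.lean` (same instance, BY NAME), and model-7's polar-ray glue (`Models/FluxSurfacePolarRayGlue/
Tube.lean`).  THIS FILE: §1 the objects of the level `ψ_N = 9/10` (`u₀ = U(X_a,0)/10`, the radial-derivative field `CFIterLike.QHalf.Dfield` (= the `ψ_N = 1/2` one),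
the approximant in the polar angle `mθ`, the glued ray radius `ρ`), §2 the per-panel link record `LinkData` (tube radius
`r`, strip slope bounds, relative envelope `(1 − ε, κ⁺)`, final bracket `[Lo, Hi]`) and its decidable rational side conditions `LinkData.check`
(same 26 inequalities as the `ψ_N = 1/2` file; `CFIterLike.QHalf.XaLoQ`, `piLoQ/piHiQ` BY NAME).
The relative tube envelope algebra is the ITER-like file's `CFIterLike.QHalf.envelope` BY NAME (pure algebra); the per-panel link theorem is
the sequel `Models/CerfonFreidbergIterLikeQ90Panel.lean`.  MODELLED: analytic Cerfon–Freidberg family (ITER-like triple `(8/25, 17/10, 33/100)`);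
`q` of a MODEL surface — nothing about a device or stability.  No `decide` here.  Typer/prover: gridfusion-model-5 (g8), 2026-08-27.
Citations: Freidberg 2014 §6.3.5 (6.35) [Freidberg2014].
-/

noncomputable section

open Set MeasureTheory intervalIntegral
open Literature.Analysis.ValidatedNumerics Literature.Analysis.ValidatedNumerics.PolyMP
open Literature.Analysis.ValidatedNumerics.NumericsMP Literature.Analysis.ValidatedNumerics.ExpPoly
open Literature.MathematicalPhysics.MHD Literature.MathematicalPhysics.MHD.CerfonFreidberg
open Summit.Ventures.FusionMHD.Models.PolarRay

set_option autoImplicit false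

namespace Summit.Ventures.FusionMHD.Models.CFIterLike.Q90

/-! ## §1 Objects (`ψ_N = 9/10`) -/

/-- The level of the surface `ψ_N = 9/10`: `u₀ = U(X_a, 0)/10`. -/
def u₀ : ℝ := 1 / 10 * U Xa 0

/-- THE `ψ_N = 9/10` APPROXIMANT in the polar angle: `m(θ) = mA(θ/π)`. -/
def mθ (θ : ℝ) : ℝ := mA (θ / Real.pi)

/-- THE RAY RADIUS of the surface `U = u₀ = U(X_a,0)/10` about the magnetic axis (model-7's glued least root). -/
def ρ (θ : ℝ) : ℝ := rayRadius U Xa 0 u₀ θ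

/-! ## §2 Per-panel link data and its rational side conditions (`ψ_N = 9/10`) -/

/-- Per-panel link constants (`ψ_N = 9/10`; same fields as `CFIterLike.QHalf.LinkData`): tube radius `r`, strip slope bounds `lam ≤ D_r ≤ dtop`,
relative envelope `(1 − eps, kplus)`, and the final bracket `[Lo, Hi]` of the panel integral. -/
structure LinkData where
  /-- panel index -/
  j : ℕ
  /-- tube radius -/
  r : ℚ
  /-- lower bound of `D_r` on the strip -/
  lam : ℚ
  /-- upper bound of `D_r` on the strip -/
  dtop : ℚ
  /-- relative lower envelope deficit -/
  eps : ℚ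
  /-- relative upper envelope factor -/
  kplus : ℚ
  /-- claimed lower bound of the panel integral -/
  Lo : ℚ
  /-- claimed upper bound of the panel integral -/
  Hi : ℚ

/-- THE RATIONAL SIDE CONDITIONS (`ψ_N = 9/10`) linking a panel certificate `d`, its box data `b` and the link constants `ℓ` (decided per panel). -/
def LinkData.check (ℓ : LinkData) (d : PanelCert) (b : BoxData) : Bool :=
  decide (b.j = d.j) && decide (ℓ.j = d.j)
  && decide (b.thlo ≤ CFIterLike.QHalf.piLoQ * panelLeft CFIterLike.QHalf.hw d.j)
  && decide (CFIterLike.QHalf.piHiQ * panelLeft CFIterLike.QHalf.hw (d.j + 1) ≤ b.thhi)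
  && decide (0 < b.sA) && decide (b.sA + ℓ.r ≤ (d.mlo : ℚ) / CFIterLike.QHalf.tmS)
  && decide ((d.mhi : ℚ) / CFIterLike.QHalf.tmS + ℓ.r ≤ b.smax)
  && decide (0 < ℓ.r) && decide ((d.eta : ℚ) / CFIterLike.QHalf.tmS < ℓ.r * ((d.dlo : ℚ) / CFIterLike.QHalf.tmS - b.M * ℓ.r))
  && decide (0 < ℓ.lam) && decide (ℓ.lam + b.M * ((d.mhi : ℚ) / CFIterLike.QHalf.tmS - b.sA) ≤ (d.dlo : ℚ) / CFIterLike.QHalf.tmS)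
  && decide (ℓ.lam + b.M * (b.smax - (d.mlo : ℚ) / CFIterLike.QHalf.tmS) ≤ (d.dlo : ℚ) / CFIterLike.QHalf.tmS)
  && decide ((d.dhi : ℚ) / CFIterLike.QHalf.tmS + b.M * ((d.mhi : ℚ) / CFIterLike.QHalf.tmS - b.sA) ≤ ℓ.dtop)
  && decide ((d.dhi : ℚ) / CFIterLike.QHalf.tmS + b.M * (b.smax - (d.mlo : ℚ) / CFIterLike.QHalf.tmS) ≤ ℓ.dtop)
  && decide (0 ≤ b.M) && decide (0 < d.mlo) && decide (0 < d.dlo) && decide (0 ≤ d.plo) && decide (0 < b.kap)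
  && decide (ℓ.r / ((d.mlo : ℚ) / CFIterLike.QHalf.tmS) + ℓ.r / (CFIterLike.QHalf.XaLoQ - b.smax) + b.M * ℓ.r / ((d.dlo : ℚ) / CFIterLike.QHalf.tmS) ≤ ℓ.eps)
  && decide (ℓ.eps ≤ 1)
  && decide (ℓ.r < CFIterLike.QHalf.XaLoQ - b.smax) && decide (b.M * ℓ.r < (d.dlo : ℚ) / CFIterLike.QHalf.tmS)
  && decide (1 + ℓ.r / ((d.mlo : ℚ) / CFIterLike.QHalf.tmS)
      ≤ ℓ.kplus * (1 - ℓ.r / (CFIterLike.QHalf.XaLoQ - b.smax)) * (1 - b.M * ℓ.r / ((d.dlo : ℚ) / CFIterLike.QHalf.tmS)))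
  && decide (ℓ.Lo ≤ (1 - ℓ.eps) * ((d.plo : ℚ) / CFIterLike.QHalf.tmS)) && decide (ℓ.kplus * ((d.phi : ℚ) / CFIterLike.QHalf.tmS) ≤ ℓ.Hi)

end Summit.Ventures.FusionMHD.Models.CFIterLike.Q90

end
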